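import Summits.CriticalPhenomena.PercolationContinuityZ3.Theorems.PercNearOneGluingNoHeavyLowerTailSahiOneStepFibreDefs
import Mathlib.Combinatorics.SetFamily.HarrisKleitman
import HarnessLib

/-!
# One-step scheme: FIBREWISE (coefficientwise) HARRIS

Support file (prover prim-ineq-prove-3 gen 36; `--supports stmt-CriticalPhenomena-4575`; memo
`run/shared/lean/prim/prim-ineq-prove-3/FINDING-G36-FIBRE-TRANSPORT.md` §0(E), §5).  No named facts, no sorries, no `native_decide`.

Writing `Cov(1_A,1_B) = Σ_{(S,S′)} wtW S · wtW S′ · [1_{A∩B}(S) − 1_A(S)1_B(S′)]` over pairs of `F`-patterns and grouping the pairs by the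
fibre `(S ∩ S′, S ∪ S′) = (I, J)` (on which the pair weight is constant, `wtW_mul_wtW_eq`), Harris' inequality for a product measure
is the statement that the total is `≥ 0`.  This file proves the FIBREWISE statement: for all up-sets `A, B` and EVERY fibre `(I, J)`
the fibre sum `Σ_{S∩S′=I, S∪S′=J} [1_{A∩B}(S) − 1_A(S)1_B(S′)]` is `≥ 0` (`harris_fibre_sum_nonneg`) — equivalently, the polynomial
`Cov(1_A,1_B)·Π(1+rᵢ)²` in the odds `rᵢ` has nonnegative coefficients ("polynomial Harris" of memo gen 19 §0(iv) follows by grouping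
fibres of equal `|I|+|J|`).  Inside a fibre, `S = I ∪ U`, `S′ = I ∪ (D ∖ U)` with `D = J ∖ I` and `U ⊆ D` free, so the fibre sum is
`#{U : I∪U ∈ A∩B} − #{U : I∪U ∈ A, I∪(D∖U) ∈ B}`, and the inequality is the Harris–Kleitman inequality on the cube `2^D` applied twice
(`card_filter_sdiff_mem_le_card_inter`: an up-set meets the reflection of an up-set at most as often as it meets the up-set itself).
Families "upward closed inside `2^D`" are handled through their reflections `U ↦ D ∖ U`, which are lower sets of finsets, so that
Mathlib's `IsLowerSet.le_card_inter_finset'` applies.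
-/

namespace Summit.CriticalPhenomena.PercolationContinuityZ3.Theorems

namespace SahiOneStep

open Finset
open Literature.Probability.Percolation.DecisionTree (ind ind_of_mem ind_of_not_mem)
open scoped Classical

variable {ι : Type*} [DecidableEq ι]

/-! ## Harris–Kleitman inside a sub-cube `2^D` -/

/-- `U ↦ D ∖ U` is injective on subsets of `D`. [folklore] -/
theorem sdiff_injOn_subsets (D : Finset ι) {U V : Finset ι} (hU : U ⊆ D) (hV : V ⊆ D) (h : D \ U = D \ V) : U = V := by
  have : D \ (D \ U) = D \ (D \ V) := by rw [h]
  rwa [Finset.sdiff_sdiff_eq_self hU, Finset.sdiff_sdiff_eq_self hV] at this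

/-- The reflection `{D ∖ U : U ∈ 𝒜}` of a family of subsets of `D` has the same cardinality. [folklore] -/
theorem card_image_sdiff_of_subsets {D : Finset ι} {𝒜 : Finset (Finset ι)} (h𝒜D : ∀ U ∈ 𝒜, U ⊆ D) :
    #(𝒜.image fun U => D \ U) = #𝒜 :=
  card_image_of_injOn fun U hU V hV hUV => sdiff_injOn_subsets D (h𝒜D U hU) (h𝒜D V hV) hUV

/-- Membership in the reflection of a family of subsets of `D`. [folklore] -/
theorem mem_image_sdiff_iff {D : Finset ι} {𝒜 : Finset (Finset ι)} (h𝒜D : ∀ U ∈ 𝒜, U ⊆ D) {V : Finset ι} (hV : V ⊆ D) :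
    V ∈ 𝒜.image (fun U => D \ U) ↔ D \ V ∈ 𝒜 := by
  rw [mem_image]
  constructor
  · rintro ⟨U, hU, rfl⟩
    rwa [Finset.sdiff_sdiff_eq_self (h𝒜D U hU)]
  · intro hDV
    exact ⟨D \ V, hDV, Finset.sdiff_sdiff_eq_self hV⟩

/-- Members of a reflected family are subsets of `D`. [folklore] -/
theorem subset_of_mem_image_sdiff {D : Finset ι} {𝒜 : Finset (Finset ι)} {V : Finset ι} (hV : V ∈ 𝒜.image (fun U => D \ U)) :
    V ⊆ D := by
  obtain ⟨U, -, rfl⟩ := mem_image.1 hV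
  exact sdiff_subset

/-- The reflection of a family upward closed inside `2^D` is a lower set of finsets. [folklore] -/
theorem isLowerSet_reflect_within {D : Finset ι} {𝒜 : Finset (Finset ι)} (h𝒜D : ∀ U ∈ 𝒜, U ⊆ D)
    (h𝒜up : ∀ U ∈ 𝒜, ∀ V : Finset ι, U ⊆ V → V ⊆ D → V ∈ 𝒜) :
    IsLowerSet ((𝒜.image fun U => D \ U : Finset (Finset ι)) : Set (Finset ι)) := by
  intro V W hWV hV
  have hVr : V ∈ 𝒜.image (fun U => D \ U) := hV
  have hVD : V ⊆ D := subset_of_mem_image_sdiff hVr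
  have hWD : W ⊆ D := (show W ⊆ V from hWV).trans hVD
  have hDV : D \ V ∈ 𝒜 := (mem_image_sdiff_iff h𝒜D hVD).1 hVr
  show W ∈ 𝒜.image (fun U => D \ U)
  rw [mem_image_sdiff_iff h𝒜D hWD]
  exact h𝒜up _ hDV _ (sdiff_subset_sdiff subset_rfl hWV) sdiff_subset

/-- The complement inside `2^D` of a family upward closed inside `2^D` is a lower set of finsets. [folklore] -/
theorem isLowerSet_powerset_sdiff {D : Finset ι} {𝒜 : Finset (Finset ι)}
    (h𝒜up : ∀ U ∈ 𝒜, ∀ V : Finset ι, U ⊆ V → V ⊆ D → V ∈ 𝒜) :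
    IsLowerSet ((D.powerset \ 𝒜 : Finset (Finset ι)) : Set (Finset ι)) := by
  intro V W hWV hV
  have hV' : V ∈ D.powerset \ 𝒜 := hV
  rw [mem_sdiff, mem_powerset] at hV'
  show W ∈ D.powerset \ 𝒜
  rw [mem_sdiff, mem_powerset]
  refine ⟨(show W ⊆ V from hWV).trans hV'.1, fun hW => hV'.2 ?_⟩
  exact h𝒜up _ hW _ hWV hV'.1

/-- **Harris inside `2^D`** (from Harris–Kleitman): two families of subsets of `D`, upward closed inside `2^D`, satisfy
`#𝒜 · #ℬ ≤ 2^{#D} · #(𝒜 ∩ ℬ)`. [folklore] -/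
theorem card_mul_le_pow_mul_card_inter {D : Finset ι} {𝒜 ℬ : Finset (Finset ι)}
    (h𝒜D : ∀ U ∈ 𝒜, U ⊆ D) (h𝒜up : ∀ U ∈ 𝒜, ∀ V : Finset ι, U ⊆ V → V ⊆ D → V ∈ 𝒜)
    (hℬD : ∀ U ∈ ℬ, U ⊆ D) (hℬup : ∀ U ∈ ℬ, ∀ V : Finset ι, U ⊆ V → V ⊆ D → V ∈ ℬ) :
    #𝒜 * #ℬ ≤ 2 ^ #D * #(𝒜 ∩ ℬ) := by
  have key := (isLowerSet_reflect_within h𝒜D h𝒜up).le_card_inter_finset' (isLowerSet_reflect_within hℬD hℬup)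
    (s := D) (fun V hV => subset_of_mem_image_sdiff hV) (fun V hV => subset_of_mem_image_sdiff hV)
  rw [card_image_sdiff_of_subsets h𝒜D, card_image_sdiff_of_subsets hℬD] at key
  have hABD : ∀ U ∈ 𝒜 ∩ ℬ, U ⊆ D := fun U hU => h𝒜D U (mem_inter.1 hU).1
  have hint : 𝒜.image (fun U => D \ U) ∩ ℬ.image (fun U => D \ U) = (𝒜 ∩ ℬ).image (fun U => D \ U) := by
    ext V
    rw [mem_inter]
    constructor
    · rintro ⟨h1, h2⟩
      have hVD := subset_of_mem_image_sdiff h1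
      rw [mem_image_sdiff_iff hABD hVD, mem_inter]
      exact ⟨(mem_image_sdiff_iff h𝒜D hVD).1 h1, (mem_image_sdiff_iff hℬD hVD).1 h2⟩
    · intro hV
      have hVD := subset_of_mem_image_sdiff hV
      have hm := (mem_image_sdiff_iff hABD hVD).1 hV
      rw [mem_inter] at hm
      exact ⟨(mem_image_sdiff_iff h𝒜D hVD).2 hm.1, (mem_image_sdiff_iff hℬD hVD).2 hm.2⟩
  rwa [hint, card_image_sdiff_of_subsets hABD] at key

/-- **Kleitman inside `2^D`, reflected form**: for families `𝒜, ℬ` of subsets of `D`, upward closed inside `2^D`,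
`2^{#D} · #{U ∈ 𝒜 : D ∖ U ∈ ℬ} ≤ #𝒜 · #ℬ`. [folklore] -/
theorem pow_mul_card_filter_sdiff_mem_le {D : Finset ι} {𝒜 ℬ : Finset (Finset ι)}
    (h𝒜D : ∀ U ∈ 𝒜, U ⊆ D) (h𝒜up : ∀ U ∈ 𝒜, ∀ V : Finset ι, U ⊆ V → V ⊆ D → V ∈ 𝒜)
    (hℬD : ∀ U ∈ ℬ, U ⊆ D) (hℬup : ∀ U ∈ ℬ, ∀ V : Finset ι, U ⊆ V → V ⊆ D → V ∈ ℬ) :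
    2 ^ #D * #(𝒜.filter fun U => D \ U ∈ ℬ) ≤ #𝒜 * #ℬ := by
  -- `𝒞 := 2^D ∖ 𝒜` and the reflection `ℬ̌` of `ℬ` are lower sets; Kleitman: `#𝒞 · #ℬ̌ ≤ 2^{#D} · #(𝒞 ∩ ℬ̌)`.
  set 𝒞 : Finset (Finset ι) := D.powerset \ 𝒜 with h𝒞
  set ℬr : Finset (Finset ι) := ℬ.image (fun U => D \ U) with hℬr
  have kl := (isLowerSet_powerset_sdiff (D := D) h𝒜up).le_card_inter_finset' (isLowerSet_reflect_within hℬD hℬup) (s := D)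
    (fun V hV => by
      have hV' : V ∈ D.powerset \ 𝒜 := hV
      exact mem_powerset.1 (mem_sdiff.1 hV').1)
    (fun V hV => subset_of_mem_image_sdiff hV)
  have h𝒜P : 𝒜 ⊆ D.powerset := fun U hU => mem_powerset.2 (h𝒜D U hU)
  have hcard𝒞 : #𝒞 + #𝒜 = 2 ^ #D := by
    rw [h𝒞, card_sdiff_add_card_eq_card h𝒜P, card_powerset]
  -- `#{U ∈ 𝒜 : D∖U ∈ ℬ} = #(𝒜 ∩ ℬ̌)`
  have hfilt : 𝒜.filter (fun U => D \ U ∈ ℬ) = 𝒜 ∩ ℬr := by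
    ext U
    rw [mem_filter, mem_inter]
    constructor
    · rintro ⟨hU, hDU⟩
      exact ⟨hU, (mem_image_sdiff_iff hℬD (h𝒜D U hU)).2 hDU⟩
    · rintro ⟨hU, hr⟩
      exact ⟨hU, (mem_image_sdiff_iff hℬD (h𝒜D U hU)).1 hr⟩
  -- `#ℬ̌ = #(𝒜 ∩ ℬ̌) + #(𝒞 ∩ ℬ̌)`
  have hsplit : #(𝒜 ∩ ℬr) + #(𝒞 ∩ ℬr) = #ℬr := by
    have hdisj : Disjoint (𝒜 ∩ ℬr) (𝒞 ∩ ℬr) := by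
      rw [h𝒞, disjoint_left]
      intro V h1 h2
      exact (mem_sdiff.1 (mem_inter.1 h2).1).2 (mem_inter.1 h1).1
    rw [← card_union_of_disjoint hdisj]
    congr 1
    ext V
    simp only [mem_union, mem_inter, h𝒞, mem_sdiff, mem_powerset]
    constructor
    · rintro (⟨_, h⟩ | ⟨_, h⟩) <;> exact h
    · intro hV
      by_cases hVA : V ∈ 𝒜
      · exact Or.inl ⟨hVA, hV⟩
      · exact Or.inr ⟨⟨subset_of_mem_image_sdiff hV, hVA⟩, hV⟩
  have hcardr : #ℬr = #ℬ := card_image_sdiff_of_subsets hℬD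
  rw [hcardr] at hsplit
  rw [hfilt]
  rw [hcardr] at kl
  -- arithmetic in ℤ
  have hle : #𝒜 ≤ 2 ^ #D := by omega
  have e1 : #𝒞 = 2 ^ #D - #𝒜 := by omega
  rw [e1] at kl
  zify [hle] at kl hsplit ⊢
  nlinarith [kl, hsplit, Nat.zero_le (#𝒜), Nat.zero_le (#ℬ), Nat.zero_le (#(𝒞 ∩ ℬr)), Nat.zero_le (#(𝒜 ∩ ℬr))]

/-- **An up-set meets the reflection of an up-set at most as often as it meets the up-set itself**: for families `𝒜, ℬ`
of subsets of `D`, upward closed inside `2^D`, `#{U ∈ 𝒜 : D ∖ U ∈ ℬ} ≤ #(𝒜 ∩ ℬ)` (Harris–Kleitman twice). [this work] -/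
theorem card_filter_sdiff_mem_le_card_inter {D : Finset ι} {𝒜 ℬ : Finset (Finset ι)}
    (h𝒜D : ∀ U ∈ 𝒜, U ⊆ D) (h𝒜up : ∀ U ∈ 𝒜, ∀ V : Finset ι, U ⊆ V → V ⊆ D → V ∈ 𝒜)
    (hℬD : ∀ U ∈ ℬ, U ⊆ D) (hℬup : ∀ U ∈ ℬ, ∀ V : Finset ι, U ⊆ V → V ⊆ D → V ∈ ℬ) :
    #(𝒜.filter fun U => D \ U ∈ ℬ) ≤ #(𝒜 ∩ ℬ) := by
  have h1 := pow_mul_card_filter_sdiff_mem_le h𝒜D h𝒜up hℬD hℬup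
  have h2 := card_mul_le_pow_mul_card_inter h𝒜D h𝒜up hℬD hℬup
  have hpos : 0 < 2 ^ #D := by positivity
  exact Nat.le_of_mul_le_mul_left (h1.trans h2) hpos

/-! ## The fibre sum of the Harris kernel -/

/-- **FIBREWISE HARRIS.**  For up-sets `A, B` and every fibre `(I, J)`, the sum over the pairs of `F`-patterns `(S,S′)` with
`S ∩ S′ = I`, `S ∪ S′ = J` of `1_{A∩B}(S) − 1_A(S)·1_B(S′)` is nonnegative. [this work] -/
theorem harris_fibre_sum_nonneg (F : Finset ι) {A B : Set (Set ι)} (hA : IsUpperSet A) (hB : IsUpperSet B) (I J : Finset ι) :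
    0 ≤ ∑ x ∈ (F.powerset ×ˢ F.powerset).filter (fun x => (x.1 ∩ x.2, x.1 ∪ x.2) = (I, J)),
        (ind (pat (A ∩ B)) x.1 - ind (pat A) x.1 * ind (pat B) x.2) := by
  set D := J \ I with hD
  set fib := (F.powerset ×ˢ F.powerset).filter (fun x => (x.1 ∩ x.2, x.1 ∪ x.2) = (I, J)) with hfib
  by_cases hIJ : I ⊆ J ∧ J ⊆ F
  swap
  · -- the fibre is empty
    have : fib = ∅ := by
      rw [hfib, filter_eq_empty_iff]
      intro x hx hxe
      rw [mem_product, mem_powerset, mem_powerset] at hx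
      simp only [Prod.mk.injEq] at hxe
      apply hIJ
      refine ⟨?_, ?_⟩
      · rw [← hxe.1, ← hxe.2]; exact inter_subset_left.trans subset_union_left
      · rw [← hxe.2]; exact union_subset hx.1 hx.2
    rw [this, sum_empty]
  obtain ⟨hIJ', hJF⟩ := hIJ
  -- parametrise the fibre by `U ⊆ D`: `x = (I ∪ U, I ∪ (D ∖ U))`
  let φ : Finset ι → Finset ι × Finset ι := fun U => (I ∪ U, I ∪ (D \ U))
  have hφ_mem : ∀ U ∈ D.powerset, φ U ∈ fib := by
    intro U hU
    rw [mem_powerset] at hU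
    have hUJ : U ⊆ J := hU.trans sdiff_subset
    rw [hfib, mem_filter, mem_product, mem_powerset, mem_powerset]
    refine ⟨⟨(union_subset hIJ' hUJ).trans hJF, (union_subset hIJ' (sdiff_subset.trans sdiff_subset)).trans
      (show J ⊆ F from hJF)⟩, ?_⟩
    simp only [φ, Prod.mk.injEq]
    constructor
    · -- (I ∪ U) ∩ (I ∪ (D \ U)) = I
      ext i
      simp only [mem_inter, mem_union, mem_sdiff, hD]
      constructor
      · rintro ⟨h1 | h1, h2 | h2⟩
        · exact h1
        · exact h1
        · exact h2
        · exact absurd h1 h2.2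
      · intro hi; exact ⟨Or.inl hi, Or.inl hi⟩
    · -- (I ∪ U) ∪ (I ∪ (D \ U)) = J
      ext i
      simp only [mem_union, mem_sdiff, hD]
      constructor
      · rintro ((h | h) | h | h)
        · exact hIJ' h
        · exact hUJ h
        · exact hIJ' h
        · exact h.1.1
      · intro hi
        by_cases hiI : i ∈ I
        · exact Or.inl (Or.inl hiI)
        · by_cases hiU : i ∈ U
          · exact Or.inl (Or.inr hiU)
          · exact Or.inr (Or.inr ⟨⟨hi, hiI⟩, hiU⟩)
  have hφ_inj : Set.InjOn φ ↑(D.powerset) := by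
    intro U hU V hV hUV
    have hU' : U ⊆ D := mem_powerset.1 hU
    have hV' : V ⊆ D := mem_powerset.1 hV
    have h1 : I ∪ U = I ∪ V := congrArg Prod.fst hUV
    have hUI : Disjoint U I := disjoint_of_subset_left hU' disjoint_sdiff_self_left
    have hVI : Disjoint V I := disjoint_of_subset_left hV' disjoint_sdiff_self_left
    ext i
    constructor
    · intro hi
      have : i ∈ I ∪ V := h1 ▸ mem_union_right I hi
      rcases mem_union.1 this with h | h
      · exact absurd h (disjoint_left.1 hUI hi)
      · exact h
    · intro hi
      have : i ∈ I ∪ U := h1.symm ▸ mem_union_right I hi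
      rcases mem_union.1 this with h | h
      · exact absurd h (disjoint_left.1 hVI hi)
      · exact h
  have hφ_surj : ∀ x ∈ fib, ∃ U ∈ D.powerset, φ U = x := by
    intro x hx
    rw [hfib, mem_filter] at hx
    obtain ⟨-, hxe⟩ := hx
    simp only [Prod.mk.injEq] at hxe
    obtain ⟨h1, h2⟩ := hxe
    refine ⟨x.1 \ I, mem_powerset.2 ?_, ?_⟩
    · rw [hD, ← h1, ← h2]
      intro i hi
      rw [mem_sdiff] at hi ⊢
      exact ⟨mem_union_left _ hi.1, hi.2⟩
    · have e1 : I ∪ (x.1 \ I) = x.1 := by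
        rw [union_sdiff_self_eq_union, union_eq_right.2]
        rw [← h1]; exact inter_subset_left
      have e2 : I ∪ (D \ (x.1 \ I)) = x.2 := by
        ext i
        simp only [mem_union, mem_sdiff, hD]
        constructor
        · rintro (hi | ⟨⟨hiJ, hiI⟩, hn⟩)
          · rw [← h1] at hi; exact (mem_inter.1 hi).2
          · rw [← h2] at hiJ
            rcases mem_union.1 hiJ with h | h
            · exact absurd ⟨h, hiI⟩ hn
            · exact h
        · intro hi
          by_cases hiI : i ∈ I
          · exact Or.inl hiI
          · refine Or.inr ⟨⟨?_, hiI⟩, fun hc => hiI ?_⟩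
            · rw [← h2]; exact mem_union_right _ hi
            · rw [← h1]; exact mem_inter.2 ⟨hc.1, hi⟩
      exact Prod.ext e1 e2
  rw [← sum_nbij φ hφ_mem hφ_inj hφ_surj (fun _ _ => rfl)]
  -- now a sum over `U ⊆ D`
  set 𝒜 := D.powerset.filter (fun U => (↑(I ∪ U) : Set ι) ∈ A) with h𝒜
  set ℬ := D.powerset.filter (fun U => (↑(I ∪ U) : Set ι) ∈ B) with hℬ
  have h𝒜D : ∀ U ∈ 𝒜, U ⊆ D := fun U hU => mem_powerset.1 (mem_filter.1 hU).1
  have hℬD : ∀ U ∈ ℬ, U ⊆ D := fun U hU => mem_powerset.1 (mem_filter.1 hU).1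
  have h𝒜up : ∀ U ∈ 𝒜, ∀ V : Finset ι, U ⊆ V → V ⊆ D → V ∈ 𝒜 := by
    intro U hU V hUV hVD
    rw [h𝒜, mem_filter, mem_powerset]
    exact ⟨hVD, hA (coe_subset.2 (union_subset_union subset_rfl hUV)) (mem_filter.1 hU).2⟩
  have hℬup : ∀ U ∈ ℬ, ∀ V : Finset ι, U ⊆ V → V ⊆ D → V ∈ ℬ := by
    intro U hU V hUV hVD
    rw [hℬ, mem_filter, mem_powerset]
    exact ⟨hVD, hB (coe_subset.2 (union_subset_union subset_rfl hUV)) (mem_filter.1 hU).2⟩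
  have hterm : ∀ U ∈ D.powerset,
      (ind (pat (A ∩ B)) (φ U).1 - ind (pat A) (φ U).1 * ind (pat B) (φ U).2 : ℝ) =
        (if U ∈ 𝒜 ∩ ℬ then (1 : ℝ) else 0) - (if U ∈ 𝒜.filter (fun U => D \ U ∈ ℬ) then (1 : ℝ) else 0) := by
    intro U hU
    have hDU : D \ U ∈ D.powerset := mem_powerset.2 sdiff_subset
    have m𝒜 : U ∈ 𝒜 ↔ (↑(I ∪ U) : Set ι) ∈ A := by rw [h𝒜, mem_filter]; exact ⟨fun h => h.2, fun h => ⟨hU, h⟩⟩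
    have mℬ : U ∈ ℬ ↔ (↑(I ∪ U) : Set ι) ∈ B := by rw [hℬ, mem_filter]; exact ⟨fun h => h.2, fun h => ⟨hU, h⟩⟩
    have mℬ' : D \ U ∈ ℬ ↔ (↑(I ∪ (D \ U)) : Set ι) ∈ B := by
      rw [hℬ, mem_filter]; exact ⟨fun h => h.2, fun h => ⟨hDU, h⟩⟩
    have c1 : (φ U).1 ∈ pat (A ∩ B) ↔ U ∈ 𝒜 ∩ ℬ := by
      rw [mem_inter, m𝒜, mℬ]; exact Iff.rfl
    have c2 : (φ U).1 ∈ pat A ↔ U ∈ 𝒜 := by rw [m𝒜]; exact Iff.rfl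
    have c3 : (φ U).2 ∈ pat B ↔ D \ U ∈ ℬ := by rw [mℬ']; exact Iff.rfl
    have c4 : U ∈ 𝒜.filter (fun U => D \ U ∈ ℬ) ↔ U ∈ 𝒜 ∧ D \ U ∈ ℬ := mem_filter
    have i1 : ind (pat (A ∩ B)) (φ U).1 = if U ∈ 𝒜 ∩ ℬ then (1 : ℝ) else 0 := by
      unfold ind; exact if_congr c1 rfl rfl
    have i2 : ind (pat A) (φ U).1 = if U ∈ 𝒜 then (1 : ℝ) else 0 := by
      unfold ind; exact if_congr c2 rfl rfl
    have i3 : ind (pat B) (φ U).2 = if D \ U ∈ ℬ then (1 : ℝ) else 0 := by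
      unfold ind; exact if_congr c3 rfl rfl
    have i4 : (if U ∈ 𝒜.filter (fun U => D \ U ∈ ℬ) then (1 : ℝ) else 0) = if (U ∈ 𝒜 ∧ D \ U ∈ ℬ) then (1 : ℝ) else 0 :=
      if_congr c4 rfl rfl
    rw [i1, i2, i3, i4]
    by_cases p1 : U ∈ 𝒜 <;> by_cases p3 : D \ U ∈ ℬ <;> simp [p1, p3]
  rw [sum_congr rfl hterm, sum_sub_distrib]
  have s1 : ∑ U ∈ D.powerset, (if U ∈ 𝒜 ∩ ℬ then (1 : ℝ) else 0) = #(𝒜 ∩ ℬ) := by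
    rw [sum_boole]
    congr 2
    ext U
    simp only [mem_filter, mem_inter, and_iff_right_iff_imp]
    intro h; exact mem_powerset.2 (h𝒜D U h.1)
  have s2 : ∑ U ∈ D.powerset, (if U ∈ 𝒜.filter (fun U => D \ U ∈ ℬ) then (1 : ℝ) else 0) =
      #(𝒜.filter fun U => D \ U ∈ ℬ) := by
    rw [sum_boole]
    congr 2
    ext U
    simp only [mem_filter, and_iff_right_iff_imp]
    intro h; exact mem_powerset.2 (h𝒜D U h.1)
  rw [s1, s2, sub_nonneg]
  exact_mod_cast card_filter_sdiff_mem_le_card_inter h𝒜D h𝒜up hℬD hℬup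

end SahiOneStep

end Summit.CriticalPhenomena.PercolationContinuityZ3.Theorems
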